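import Literature.NumberTheory.EllipticCurves.JetchevSkinnerWan2017.AnticyclotomicControl
import Literature.NumberTheory.EllipticCurves.HeegnerPointsKolyvaginGoodReductionProofs
import Literature.NumberTheory.EllipticCurves.TamagawaSubgroupProofs
import Literature.NumberTheory.EllipticCurves.LFunctionPrimeCoeff
import Literature.NumberTheory.EllipticCurves.ModularityVersionApProofs
import HarnessLib

/-!
# Jetchev–Skinner–Wan 2017, Thm. 3.3.1 with (3.5.d): the ANTICYCLOTOMIC CONTROL THEOREM for an
# elliptic curve over `ℚ` at a GOOD prime `p ≥ 3` split in `K` — the GENERAL form in the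
# imaginary quadratic field `K` (non-split primes of `N` allowed; Tamagawa factor over the places of
# `K` above the primes of `N` SPLIT in `K`), on the Literature object `X_ac`

HONEST FRAMING (cell `b2b-bsdres`, run/shared/lean/b2b/bsd-rank1-residual/; page 1 everywhere):
the goal of the cell is to DELETE the COMBINATION-SHAPED residual classes of the BSD formula for ALL
analytic-rank `≤ 1` curves over `ℚ` from PUBLISHED theorems only, so that the remainder becomes
exactly the CONSTRUCTION-SHAPED classes, which are TYPED, not attempted; this is not "finishing
BSD". This file vendors ONE published statement as a named fact (`def … : Prop`, nothing asserted;
D-0014/D-0026), re-homes ONE printed quantity as a definition with a body, and PROVES that the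
special case already in the tree (`thm331_anticyclotomicControl`, every `ℓ ∣ N` split) FOLLOWS from
it. Unit `b2b-bsdres-lit-cw` (off-peak literature typer, Castella–Wan / Wan-line papers, gen 8) —
executing the `-- TODO(general form)` left in `AnticyclotomicControl.lean` (lit-glue gen 6) and the
re-home named in lit-cgls S14.

## What and why

`JetchevSkinnerWan2017/AnticyclotomicControl.lean` vendors Thm. 3.3.1 + (3.5.d) in the SPECIAL CASE
where every prime `ℓ ∣ N` splits in `K` (the classical Heegner hypothesis), transcribing the printed
Tamagawa factor `∏_{w ∈ S_p∖Σ, w split} c_w^{(p)}(W)` as the `p`-part of the full product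
`∏_w c_w(E/K)`. The printed theorem has NO hypothesis on the behaviour in `K` of the primes of `N`:
`K` is any imaginary quadratic field in which `p` splits (§3, p. 10), and at a place `w ∤ p` that is
NOT split (inert or ramified) the anticyclotomic local condition is `0` (§2.3.3) and `w` contributes
nothing to `C^Σ(W)` (§3.3.3, Case 1(b): "since `w` is not split, `Ψ` is trivial on `G_{K_w}` …
`ker(r_w) = 0`"). The general form is the one USED in print at fields with a non-split prime of `N`:
Jetchev–Skinner–Wan §7.4.1 (`K'` with `q ∣ N` inert or ramified; for `N = q` prime, `q` ramified),
Castella 2018 §5 (`q` ramified, Thm. 2.3 with "`∏_{w ∣ N⁺}`"), Castella–Wan 2024 proof of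
Thm. 6.11 (MS p. 33). Its consumer in the cell is the (CTL) binder of the supersingular class X6 ∧
{`r_an = 1`} on the sub-locus {`q` nonsplit multiplicative} (`Summits/…/Supersingular/
X6RankOneErratumFieldDatum.lean`, `…Ramified.lean`), demanded at ERRATUM-TYPE fields (`q` ramified in
`K`, every other `ℓ ∣ N` and `p` split) — outside the all-split special case. The only tree object for
"`∏_{w ∣ N⁺} c_w(E/K)`" lived under `Summits/` (`X11b.tamagawaProductSplit`, sub-cell multr1); it is
RE-HOMED here with the SAME body (`splitTamagawaProduct`), so that the Summits twin is definitionally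
equal to it and re-points by `rfl`.

## Citation header (read by this seat on the store's LaTeXML text of arXiv:1512.06894 = the accepted
## manuscript of the version of record; `paper:arxiv-1512.06894`, chunks p0007 L104–L135, p0010
## L1–L40 and L40–L95, p0011 L1–L45, p0012 L50–L101, p0015 L7–L125, p0016 L1–L60, p0017 L13–L44,
## p0030 L1–L52; arXiv theorem numbers in brackets)

* Authors: Dimitar Jetchev, Christopher Skinner, Xin Wan.
* Title: *The Birch and Swinnerton-Dyer formula for elliptic curves of analytic rank one*.
* Venue: Camb. J. Math. **5** (2017), no. 3, 369–434, doi:10.4310/CJM.2017.v5.n3.a2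
  (= arXiv:1512.06894; bib key `JetchevSkinnerWan2017`). REFEREED / PUBLISHED.
* Standing setting (verbatim). §2.1 (p. 6): "Throughout, let `p ≥ 3` be a fixed prime". §3 (p. 10):
  "Let `𝒦/ℚ` be an imaginary quadratic field such that `p` splits in `𝒦`: `p = v v̄` (split). … Let
  `𝒦_∞` be the anticyclotomic `ℤ_p`-extension of `𝒦` and let `Γ = Gal(𝒦_∞/𝒦)`. … Let
  `Λ = 𝒪⟦Γ⟧` and put `M = T ⊗_𝒪 Λ^`, `Λ^ = Hom_cont(Λ, ℚ_p/ℤ_p)`. We equip `M` with an action of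
  `G_𝒦` via `ρ ⊗ Ψ⁻¹` … Given a finite set `Σ` of finite places `w ∤ p`, let
  `X_ac^Σ(M) = Hom_𝒪(H¹_{𝓕_ac^Σ}(𝒦, M), L/𝒪)`." — NO hypothesis on the primes of the level in `𝒦`.
  §2.3.3 (p. 7): the anticyclotomic Selmer structure "`H¹_{𝓕_ac}(𝒦_w, M) = H¹(𝒦_v̄, M)` if `w = v̄`;
  `H¹_ur(𝒦_w, M)` if `w ∤ p∞` is split; `0` else" (STRICT at `v`, relaxed at `v̄`; `0` at every
  non-split `w ∤ p`, inert or ramified). §3.3 (p. 11): "Let `S` be a finite set of places of `𝒦`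
  including all those at which `V` is ramified and let `S_p ⊂ S` be the subset of those not dividing
  `p`. Let `Σ ⊂ S_p`. Fix a topological generator `γ ∈ Γ`. We identify `𝒪⟦T⟧` with `Λ = 𝒪⟦Γ⟧` via
  … `1 + T ↦ γ`."
* **Theorem 3.3.1** [arXiv Thm. 8, p. 11] (Anticyclotomic Control Theorem), verbatim: "The
  `Λ`-module `X_ac^Σ(M)` is `Λ`-torsion, and if `f_ac^Σ(T)` is a generator of its characteristic
  `Λ`-ideal `Ch(X_ac^Σ(M))`, then `#𝒪/f_ac^Σ(0) = #H¹_{𝓕_ac}(𝒦, W) · C^Σ(W)`, where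
  `C^Σ(W) = #H⁰(𝒦_v, W) · #H⁰(𝒦_v̄, W) · ∏_{w ∈ S_p∖Σ, w split} #H¹_ur(𝒦_w, W) · ∏_{w∈Σ} #H¹(𝒦_w, W)`."
  Proved under §3.1 (p. 10): (geom), (pure), (sst) "`V` is semistable as a representation of
  `G_{𝒦_w}` for all `w ∣ p`", (τ-dual), (2-dim), (HT), **(irred_𝒦) "`V̄` is an irreducible
  `κ`-representation of `G_𝒦`"**, (corank 1), (sur). §3.3.3 [arXiv Prop. 11, p. 12]: "`c_w^{(p)}(W) :=
  [H¹_ur(𝒦_w, W) : H¹_f(K_w, W)] = #H¹_ur(𝒦_w, W)` are the `p`-parts of the local Tamagawa numbers";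
  Case 2(a) (ibid.): at a split `w ∤ p` where `W` is unramified the factor "is trivial since the two
  local conditions coincide"; Case 1(b): at a non-split `w ∤ p` "both `H¹_{𝓕_ac}(K_w, W)` and
  `H¹_{𝓕_ac}(K_w, M)` are trivial … `ker(r_w) = 0`". So the product in `C^∅(W)` runs over the places
  `w` of `𝒦` above the primes `ℓ ∣ N` that SPLIT in `𝒦`, each contributing the `p`-part of `c_w(E/𝒦)`.
* **§3.5, display (3.5.d)** [arXiv p. 16, (eq:modabvar-ec)], verbatim: "In the special case that
  `A_f = E` is an elliptic curve (i.e., `f` has rational coefficients), `p` is a prime of good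
  reduction, `𝒪 = ℤ_p`, and `P ∈ E(𝒦)` has infinite order, …
  `#H¹_{𝓕_ac}(𝒦, E[p^∞]) = #Ш(E/𝒦)[p^∞] · ( #ℤ_p/((1−a_p(E)+p)/p · log_{ω_E} P) /
  ([E(𝒦):ℤ·P]_p · #H⁰(𝒦_v, E[p^∞])) )²`" — `log_{ω_E}` the formal-group logarithm on
  `E(𝒦_v) = E(ℚ_p)` for the Néron differential (pp. 15–16), `v` the STRICT prime (§3.2 Prop. 3.2.1
  [arXiv Prop. 6]: `#H¹_{𝓕_ac}(𝒦,W) = #Ш_BK(W/𝒦)·(#δ_v)²`, `δ_v` the cokernel of localisation AT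
  `v`); derived (pp. 15–16) under (split), (good) `p ∤ N`, **(rank 1) `rank_ℤ E(𝒦) = 1`**, **(Ш
  𝔭-finite) `#Ш(E/𝒦)[p^∞] < ∞`**, **(𝔭-irred) "`A_f[𝔭]` is an irreducible `G_𝒦`-representation"**
  ("This shows that if (split), (rank 1), (Ш-finite), and (𝔭-irred) hold, then so do (crk 1),
  (surj_p), and (irred_𝒦)", p. 15); again NO hypothesis on the primes of `N` in `𝒦`; (geom), (pure),
  (τ-dual), (2-dim) hold by Saito et al., (sst) by `ord_p(N) ≤ 1`, "(HT) always holds for `2k = 2`"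
  (p. 15); no ordinarity ("`A_f[𝔭^∞](𝔽_p)` … is trivial unless `f` is ordinary … Hence
  `#A_f(ℚ_p)/A_f^1(ℚ_p) ⊗ 𝒪 = #𝒪/(1 − a_p + p)`", p. 16) and no `E(ℚ_p)[p] = 0` hypothesis.
* The combination at `Σ = ∅` (the two `#H⁰(𝒦_v, E[p^∞]) = #H⁰(𝒦_v̄, E[p^∞])` cancel, as the authors
  combine them in §7.4.1, p. 30, at their field `𝒦'` in which `q ∣ N` is inert or ramified — "In the
  case where `N = q` is prime, we take `N⁻ = 1` and `N⁺ = q`, which only satisfies (gen-H)" —: "it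
  follows from (eq:modabvar-ec) and the definition of `C(E[p^∞])` that `ord_p(#H¹_{𝓕_ac}(𝒦',
  E[p^∞]) · C(E[p^∞])) = ord_p(#Ш(E/𝒦')) − 2·ord_p(m_{𝒦'}) + 2·ord_p((1+p−a_p)/p · log_{ω_E}(z_{𝒦'}))
  + ord_p(∏_{w∣N⁺} c_w(E/𝒦'))`"): `ord_p f_ac(0) = ord_p #Ш(E/𝒦)[p^∞] + 2·(ord_p((1−a_p+p)/p ·
  log_{ω_E} P) − ord_p [E(𝒦):ℤP]) + ord_p ∏_{w∣N, w split in 𝒦} c_w(E/𝒦)`. The same statement in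
  the later literature: Castella, Camb. J. Math. 6 (2018) Thm. 2.3 (arXiv:1704.06608 p. 5; `K` with
  `q` RAMIFIED; Tamagawa term "`∏_{w∣N⁺, w∉Σ} c_w^{(p)}(E/K)`", `N⁺` the product of the prime factors
  of `N` split in `K`; "this follows easily from the 'Anticyclotomic Control Theorem' established in
  [JSW]"); Castella–Grossi–Lee–Skinner, Invent. Math. 227 (2022) Thm. 5.1.1 (all `ℓ ∣ N` split).

## Transcription (tree vocabulary; every symbol a Literature object) — GENERAL form

* "`E/ℚ`, `p ≥ 3`, `p ∤ N`" = a globally minimal `W` (so `a_p = W.frobeniusTrace p` and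
  `ω = dx/(2y + a₁x + a₃)` is a Néron differential), `3 ≤ p`, `Rank1Residual.Good W p`.
* "`𝒦` imaginary quadratic, `p = v v̄` splits" = `IsImaginaryQuadratic K`,
  `SatisfiesHeegnerHypothesis p K`. NOTHING is assumed about the primes of `N` in `K`.
* "`∏_{w ∈ S_p∖∅, w split} c_w^{(p)}(W)`" = the `p`-part of `splitTamagawaProduct W K :=
  ∏_{w : ℓ(w) ∣ N_E, ℓ(w) split in K} c_w(E_K)` (this file; the factor of the tree's
  `(W.baseChange K).tamagawaProduct` at those places, `1` elsewhere) — at a split `w ∤ p` unramified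
  for `W` the printed factor is `1` (§3.3.3 Case 2(a)) and `c_w(E_K) = 1` (good reduction), so the set
  `S ⊇ {ramified places}` is immaterial; at the all-split fields of the special case
  `splitTamagawaProduct W K = (W.baseChange K).tamagawaProduct` (PROVED below,
  `splitTamagawaProduct_eq_tamagawaProduct_of_heegnerHypothesis`).
* "`v` (the STRICT prime; `log_{ω_E}` on `E(𝒦_v)`)" = an embedding `ι : K →+* ℚ_[p]` and the prime
  `v` with `x ∈ v ⟺ ‖ι x‖ < 1` on `𝓞 K`; `ord_p log_{ω_E} P = padicLogOrd W p ι P`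
  (`PadicFormalLogOrder.lean`) — Castella 2018's convention (log at the strict prime), as in the
  special case.
* "`𝒦_∞`, `γ`, `Λ = 𝒪⟦T⟧`, `1 + T ↦ γ`" = an anticyclotomic `κ : ZpExtension K p`
  (`κ.IsAnticyclotomic`), a topological generator `γ` (`[Fact (κ.IsTopGenerator γ)]`),
  `IwasawaAlgebra p`.
* "`X_ac(M) = X_ac^∅(M)`" = `AcSelmer.XAc (W.baseChange K) p κ v ∅ γ` — Castella 2018 Def. 2.2's
  `X_ac(E[p^∞])` with strict prime `𝔭 = v`, `Σ = ∅`, in the `K_∞`-formulation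
  (`Castella2018/AnticyclotomicSelmer{,Dual}.lean`): strict above `v`, relaxed above `v̄`, locally
  trivial above every finite `w ∤ p`. READING CAVEAT (the flag `JSW-331-Kinf-formulation` of the
  special case travels unchanged): JSW's `H¹_{𝓕_ac}(𝒦, T ⊗ Λ^)` is the `K_∞`-level group by Shapiro's
  lemma; JSW's condition "`0`" at `v` and at every NON-SPLIT `w ∤ p` IS the tree's strict/"locally
  trivial" condition (a non-split `w` splits completely in `K_∞/K` — "`Ψ` is trivial on `G_{𝒦_w}`",
  §3.3.3 Case 1(b)); JSW's "`H¹_ur`" at a SPLIT `w ∤ p` equals "locally trivial" over `K_∞` because a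
  split `w` is finitely decomposed in `K_∞/K` (`K_{∞,η} ⊇` the unramified `ℤ_p`-extension of `𝒦_w`,
  `H¹_ur(K_{∞,η}, E[p^∞]) = H¹(Ẑ/ℤ_p, ·) = 0`). No new reading enters in the general form.
* **(irred_𝒦)** = `(W.baseChange K).HasIrreducibleModPGaloisRep p` ("`E[p]` is an irreducible
  `𝔽_p`-representation of `G_𝒦`"); in print it follows from (irr) over `ℚ` with `ρ̄_{E,p}` ramified
  at some `q ∥ N` (JSW §7.4.1 p. 30: "(irredK) is an easy consequence of the hypotheses that `ρ̄_{E,p}`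
  is irreducible and that `ρ̄_{E,p}` is ramified at the prime `q = q₁ ∥ N` (see [skinner:conversegz])")
  — not vendored here (carried by consumers as a binder, as in the special case).
* "`rank_ℤ E(𝒦) = 1`" = `(W.baseChange K).mordellWeilRank = 1`; "`#Ш(E/𝒦)[p^∞] < ∞`" =
  `Finite (primaryComponent (W.baseChange K).sha p)`; "`P` of infinite order" = `¬ IsOfFinAddOrder P`.
* Conclusion, with `#ℤ_p/(x) = p^{ord_p x}`: `X_ac` is `Λ`-torsion, `Ch = (f)` for some `f` with
  `f(0) ≠ 0`, and `ord_p f(0) = ord_p #Ш(E/𝒦)[p^∞] + 2·((ord_p(1−a_p+p) − 1 + ord_p log_{ω_E} P) −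
  ord_p[E(𝒦):ℤ·P]) + ord_p ∏_{w ∣ N, w split} c_w(E/𝒦)`.

## Contents

* `IsSplitConductorPlace W K w`, `splitTamagawaProduct W K` — the printed quantity "`∏_{w∣N⁺} c_w`"
  re-homed (definitions with bodies; SAME bodies as the Summits twins `X11b.IsPlaceOverSplitConductorPrime`
  / `X11b.tamagawaProductSplit`, which therefore equal these by `rfl`).
* PROVED: `splitTamagawaProduct_eq_tamagawaProduct_of_heegnerHypothesis` (at an all-split `K` the
  split product IS the full Tamagawa product of `E_K`: places off `N` have good reduction, `c_w = 1`).
* `thm331_anticyclotomicControl_general` — the named fact (ONE new `def … : Prop`).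
* PROVED: `thm331_anticyclotomicControl_of_general` — the tree's special case
  `thm331_anticyclotomicControl` FOLLOWS (a RETIRED-DERIVED candidate by annotation; its `def` stays
  for its importers); `hasCharValuationAt_of_thm331_general` (packaged currency);
  `thm331_general_padicVal_eq_of_generator` (generator independence).

## References
* [JetchevSkinnerWan2017] Camb. J. Math. 5 (2017) = arXiv:1512.06894: §2.1, §2.3.3, §3 (setting),
  §3.1 (assumptions), Thm. 3.3.1 [arXiv Thm. 8], §3.3.3 [arXiv Prop. 11, Cases 1(b), 2(a)], §3.5
  (3.5.d) [arXiv (eq:modabvar-ec)], §7.4.1 (the combination at a (gen-H) field).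
* [Castella2018] Camb. J. Math. 6 (2018): §2.2 (`N⁺`), Def. 2.2, Thm. 2.3 — the object and the same
  theorem with `ε_p` at a field with `q` ramified; Literature object
  `Castella2018/AnticyclotomicSelmer{,Dual}.lean`.
* [CastellaGrossiLeeSkinner2022] Invent. Math. 227 (2022) Thm. 5.1.1 (all-split; `E(ℚ_p)[p] = 0`).
* [CastellaWan2023] Math. Ann. 389 (2024), proof of Thm. 6.11 (MS p. 33): the field with `q`
  ramified, "if `N = q`, we consider `K` ramified at `q`".
* HOME/b2b-bsdres-lit-cw/CASTELLA-WAN.md §12; HOME/b2b-bsdres-lit-glue/GLUE.md GEN 6;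
  HOME/b2b-bsdres-lit-cgls/CGLS-GV-TYPING.md §12.10–12.11 (S14).
-/

set_option autoImplicit false

noncomputable section

open scoped Classical

open WeierstrassCurve NumberField IsDedekindDomain Field Literature.NumberTheory.EllipticCurves
  Literature.NumberTheory.EllipticCurves.Rank1Residual
  Literature.NumberTheory.EllipticCurves.Castella2018

namespace Literature.NumberTheory.EllipticCurves.JetchevSkinnerWan2017

/-! ### The printed Tamagawa factor `∏_{w ∣ N, w split} c_w(E/K)` ("`∏_{w ∣ N⁺} c_w`") — re-homed -/

section SplitTamagawa

variable (W : WeierstrassCurve ℚ) (K : Type) [Field K] [NumberField K]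

/-- **"`w ∈ S_p`, `w` split"** (Jetchev–Skinner–Wan Thm. 3.3.1's index set for `C^Σ(W)`) = **"`w ∣ N⁺`"**
(Castella 2018 §2.2: `N⁺` "the product of the prime factors of `N` which are split in `K`"): the
finite place `w` of `K` lies over a rational prime `ℓ` that divides the conductor `N_E` and SPLITS in
`K` (exactly two primes of `𝓞 K` above `ℓ`). Same body as the Summits twin
`X11b.IsPlaceOverSplitConductorPrime` (sub-cell multr1), re-homed.
[cite: JetchevSkinnerWan2017, Thm. 3.3.1 (arXiv:1512.06894 Thm. 8, p. 11), the index "w ∈ S_p∖Σ, w split" of C^Σ(W)]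
[cite: Castella2018, §2.2 (arXiv:1704.06608 p. 5), definition of N⁺] -/
def IsSplitConductorPlace (w : HeightOneSpectrum (𝓞 K)) : Prop :=
  ((Ideal.span {((Rat.HeightOneSpectrum.primesEquiv (w.under (𝓞 ℚ)) : ℕ) : ℤ)}).primesOver
      (𝓞 K)).ncard = 2 ∧
    ((Rat.HeightOneSpectrum.primesEquiv (w.under (𝓞 ℚ)) : ℕ) : ℕ) ∣ W.conductorNorm ℤ

/-- **`∏_{w ∣ N, w split in K} c_w(E/K)`** — the product of the local Tamagawa numbers of
`E_K = W.baseChange K` over the places `w` of `K` above the primes of `N_E` split in `K`: the factor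
"`∏_{w ∈ S_p∖Σ, w split} #H¹_ur(𝒦_w, W)`" of Jetchev–Skinner–Wan's `C^Σ(W)` at `Σ = ∅` read through
§3.3.3 ("`c_w^{(p)}(W) = #H¹_ur(𝒦_w, W)` are the `p`-parts of the local Tamagawa numbers"; trivial at a
split `w` where `W` is unramified, Case 2(a)) = Castella 2018 Thm. 2.3's "`∏_{w∣N⁺} c_w^{(p)}(E/K)`",
before taking `p`-parts. A `finprod` (finitely many factors differ from `1`); each factor is the factor
of the tree's `(W.baseChange K).tamagawaProduct` at `w`. Same body as the Summits twin
`X11b.tamagawaProductSplit` (sub-cell multr1), re-homed so that published statements can be stated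
on it. [cite: JetchevSkinnerWan2017, Thm. 3.3.1 (arXiv Thm. 8, p. 11) and §3.3.3 (arXiv Prop. 11, p. 12)]
[cite: Castella2018, Thm. 2.3 (arXiv:1704.06608 p. 5)] -/
def splitTamagawaProduct : ℕ :=
  ∏ᶠ w : HeightOneSpectrum (𝓞 K),
    if IsSplitConductorPlace W K w then
      ((W.baseChange K).baseChange (w.adicCompletion K)).localTamagawaNumber (w.adicCompletionIntegers K)
    else 1

/-- **At a field in which EVERY prime of `N` splits, `∏_{w ∣ N, w split} c_w(E/K) = ∏_w c_w(E/K)`.**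
A place `w` off the split primes of `N` then lies over a prime `ℓ ∤ N_E`, where `W` has good reduction
(`p ∣ N_E ⟺` bad reduction), hence so does `E_K` at `w` (base change of good reduction from `ℚ`), so
`c_w(E_K) = 1` — the factor of the full product there is `1` as well. This is the identification of the
Tamagawa term made in the all-split special case `thm331_anticyclotomicControl`.
[cite: JetchevSkinnerWan2017, §3.3.3 (arXiv Prop. 11, p. 12), Case 2(a)] [cite: SilvermanAEC2009, VII.2 remark after Prop. 2.1 and VII.5 Prop. 5.1(a)] -/
theorem splitTamagawaProduct_eq_tamagawaProduct_of_heegnerHypothesis [W.IsElliptic]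
    (hHN : SatisfiesHeegnerHypothesis (W.conductorNorm ℤ) K) :
    splitTamagawaProduct W K = (W.baseChange K).tamagawaProduct := by
  rw [splitTamagawaProduct, WeierstrassCurve.tamagawaProduct]
  refine finprod_congr fun w => ?_
  by_cases h : IsSplitConductorPlace W K w
  · rw [if_pos h]
  · rw [if_neg h]
    -- the prime `ℓ` under `w` does not divide `N_E`
    set v : HeightOneSpectrum (𝓞 ℚ) := w.under (𝓞 ℚ) with hvdef
    set ℓ : ℕ := (Rat.HeightOneSpectrum.primesEquiv v : ℕ) with hℓdef
    haveI hℓ : Fact ℓ.Prime := ⟨(Rat.HeightOneSpectrum.primesEquiv v).2⟩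
    have hℓN : ¬ ℓ ∣ W.conductorNorm ℤ := fun hd => h ⟨hHN ℓ hℓ.out hd, hd⟩
    -- hence good reduction of `W` at `v`, and of `E_K` at `w`
    have hgoodp : W.HasGoodReductionAtPrime ℓ := by
      by_contra hbad
      exact hℓN ((W.dvd_conductorNorm_iff_not_hasGoodReductionAtPrime ℓ).mpr hbad)
    have hgood : W.HasGoodReductionAt v :=
      (hasGoodReductionAtPrime_primesEquiv_iff_holds W v ℓ rfl).mp hgoodp
    haveI : w.asIdeal.LiesOver v.asIdeal := ⟨rfl⟩
    have hgoodK : (W.baseChange K).HasGoodReductionAt w :=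
      hasGoodReductionAt_baseChange_of_hasGoodReductionAt_rat W v w hgood
    exact ((W.baseChange K).localTamagawaNumber_eq_one_of_hasGoodReductionAt_holds w hgoodK).symm

end SplitTamagawa

/-! ### The named fact: Thm. 3.3.1 + (3.5.d), general `K` -/

/-- **Jetchev–Skinner–Wan, Camb. J. Math. 5 (2017) = arXiv:1512.06894, Theorem 3.3.1
(Anticyclotomic Control Theorem) [arXiv Thm. 8, p. 11] combined with §3.5 display (3.5.d) [arXiv
p. 16] for an elliptic curve `E/ℚ` — GENERAL imaginary quadratic `𝒦` with `p` split** (the primes of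
`N` may be split, inert or ramified in `𝒦`), as the authors combine them in §7.4.1 (p. 30, at a field
`𝒦'` in which `q ∣ N` is inert or ramified) and as restated in Castella 2018 Thm. 2.3 (`q` ramified)
/ Castella–Grossi–Lee–Skinner 2022 Thm. 5.1.1 (all split). Setting (verbatim, §2.1, §3, §3.3): "let
`p ≥ 3` be a fixed prime"; "`𝒦/ℚ` an imaginary quadratic field such that `p` splits in `𝒦`:
`p = v v̄`"; "`𝒦_∞` the anticyclotomic `ℤ_p`-extension of `𝒦`, `Γ = Gal(𝒦_∞/𝒦)`, `Λ = 𝒪⟦Γ⟧`,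
`M = T ⊗_𝒪 Λ^` with `G_𝒦` acting via `ρ ⊗ Ψ⁻¹`, `X_ac^Σ(M) = Hom_𝒪(H¹_{𝓕_ac^Σ}(𝒦, M), L/𝒪)`" for the
anticyclotomic Selmer structure "`H¹(𝒦_v̄, M)` if `w = v̄`; `H¹_ur(𝒦_w, M)` if `w ∤ p∞` is split; `0`
else" (§2.3.3); "Let `S` be a finite set of places of `𝒦` including all those at which `V` is
ramified and let `S_p ⊂ S` be the subset of those not dividing `p`. Let `Σ ⊂ S_p`. Fix a topological
generator `γ ∈ Γ`. We identify `𝒪⟦T⟧` with `Λ` via `1 + T ↦ γ`." Thm. 3.3.1 (verbatim): "The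
`Λ`-module `X_ac^Σ(M)` is `Λ`-torsion, and if `f_ac^Σ(T)` is a generator of its characteristic
`Λ`-ideal, then `#𝒪/f_ac^Σ(0) = #H¹_{𝓕_ac}(𝒦, W) · C^Σ(W)`, where `C^Σ(W) = #H⁰(𝒦_v, W)·#H⁰(𝒦_v̄,
W)·∏_{w∈S_p∖Σ, w split} #H¹_ur(𝒦_w, W)·∏_{w∈Σ} #H¹(𝒦_w, W)`" (`#H¹_ur(𝒦_w, W) = c_w^{(p)}(W)` "the
`p`-parts of the local Tamagawa numbers", trivial at a split `w` where `W` is unramified, nothing at a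
non-split `w` — §3.3.3), proved under §3.1's (geom), (pure), (sst), (τ-dual), (2-dim), (HT),
(irred_𝒦), (corank 1), (sur). (3.5.d) (verbatim): "In the special case that `A_f = E` is an elliptic
curve, `p` is a prime of good reduction, `𝒪 = ℤ_p`, and `P ∈ E(𝒦)` has infinite order …
`#H¹_{𝓕_ac}(𝒦, E[p^∞]) = #Ш(E/𝒦)[p^∞] · ( #ℤ_p/((1−a_p(E)+p)/p · log_{ω_E} P) / ([E(𝒦):ℤ·P]_p ·
#H⁰(𝒦_v, E[p^∞])) )²`", derived under (split), (good), (rank 1) `rank_ℤ E(𝒦) = 1`, (Ш-finite)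
`#Ш(E/𝒦)[p^∞] < ∞` and (𝔭-irred) "`E[p]` is an irreducible `G_𝒦`-representation", which imply
(corank 1), (sur), (irred_𝒦) (§3.5 p. 15), the remaining assumptions holding for `E/ℚ` at `p ∤ N`
("(HT) always holds for `2k = 2`"); no ordinarity, no `E(ℚ_p)[p] = 0`, and NO hypothesis on the primes
of `N` in `𝒦`. Combined at `Σ = ∅` (the two `#H⁰` cancel, §7.4.1 p. 30): `ord_p f_ac(0) = ord_p
#Ш(E/𝒦)[p^∞] + 2·(ord_p((1−a_p+p)/p·log_{ω_E} P) − ord_p[E(𝒦):ℤ·P]) + ord_p ∏_{w∣N, w split}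
c_w(E/𝒦)`. TRANSCRIBED (module docstring for the dictionary): `W` globally minimal, `3 ≤ p`,
`Good W p`; `K` imaginary quadratic with `p` split (nothing assumed at `ℓ ∣ N`); `ι : K →+* ℚ_p` and `v`
the prime induced by `ι` — the STRICT prime, the log being taken on `E(𝒦_v)`; `κ` anticyclotomic with
topological generator `γ`; `X_ac(M) = AcSelmer.XAc (W.baseChange K) p κ v ∅ γ` (the Literature object
of `Castella2018/AnticyclotomicSelmerDual.lean`, `K_∞`-formulation — flag `JSW-331-Kinf-formulation`
as in the special case: JSW's "`0`" at `v` and at non-split `w ∤ p` = the tree's strict condition,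
JSW's "`H¹_ur`" at split `w ∤ p` = "locally trivial" over `K_∞`); (irred_𝒦) =
`(W.baseChange K).HasIrreducibleModPGaloisRep p`; `∏_{w∣N, w split} c_w(E/𝒦) = splitTamagawaProduct W
K`; conclusion with `#ℤ_p/(x) = p^{ord_p x}`: torsion, `Ch = (f)`, `f(0) ≠ 0`, `ord_p f(0) = ord_p
#Ш(E/𝒦)[p^∞] + 2·((ord_p(1−a_p+p) − 1 + ord_p log_{ω_E} P) − ord_p[E(𝒦):ℤP]) + ord_p
(splitTamagawaProduct W K)` (`padicLogOrd W p ι P`). The all-split special case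
`thm331_anticyclotomicControl` follows (`thm331_anticyclotomicControl_of_general`). PUBLISHED.
[cite: JetchevSkinnerWan2017, Thm. 3.3.1 (arXiv:1512.06894 Thm. 8, p. 11) with §3.5 (3.5.d) (arXiv p. 16, (eq:modabvar-ec)), §3.3.3 (arXiv Prop. 11, p. 12, Cases 1(b), 2(a)), §3.1 (p. 10), §3 (p. 10), §2.3.3 (p. 7), §7.4.1 (p. 30)]
[cite: Castella2018, Def. 2.2 and Thm. 2.3 (arXiv:1704.06608 p. 5) (the object `X_ac`; same theorem with `ε_p`, `K` with `q` ramified, Tamagawa term `∏_{w∣N⁺} c_w^{(p)}`)]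
[cite: CastellaGrossiLeeSkinner2022, Thm. 5.1.1 and its proof ("the combination of Theorem 3.3.1 and equation (3.5.d) in [JSW]")] -/
def thm331_anticyclotomicControl_general : Prop :=
  ∀ (W : WeierstrassCurve ℚ) [W.IsElliptic] [W.IsGloballyMinimal] (p : ℕ) [Fact p.Prime],
    3 ≤ p → Good W p →
    ∀ (K : Type) [Field K] [NumberField K], IsImaginaryQuadratic K →
      SatisfiesHeegnerHypothesis p K →
      (W.baseChange K).HasIrreducibleModPGaloisRep p →
    ∀ (ι : K →+* ℚ_[p]) (v : HeightOneSpectrum (𝓞 K)),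
      (∀ x : 𝓞 K, x ∈ v.asIdeal ↔ ‖ι (x : K)‖ < 1) →
    ∀ (κ : ZpExtension K p), κ.IsAnticyclotomic →
    ∀ (γ : absoluteGaloisGroup K) [Fact (κ.IsTopGenerator γ)],
      (W.baseChange K).mordellWeilRank = 1 →
      Finite (AddCommGroup.primaryComponent (W.baseChange K).sha p) →
    ∀ (P : (W.baseChange K).toAffine.Point), ¬ IsOfFinAddOrder P →
      Module.IsTorsion (IwasawaAlgebra p) (AcSelmer.XAc (W.baseChange K) p κ v ∅ γ) ∧
      ∃ F : IwasawaAlgebra p,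
        AcSelmer.XAc.charIdeal (W.baseChange K) p κ v ∅ γ = Ideal.span {F} ∧
        PowerSeries.constantCoeff F ≠ 0 ∧
        ((PowerSeries.constantCoeff F).valuation : ℤ) =
          (padicValNat p (Nat.card (AddCommGroup.primaryComponent (W.baseChange K).sha p)) : ℤ) +
            2 * (((padicValInt p (1 - W.frobeniusTrace p + p) : ℤ) - 1 + padicLogOrd W p ι P) -
              (padicValNat p (AddSubgroup.zmultiples P).index : ℤ)) +
            (padicValNat p (splitTamagawaProduct W K) : ℤ)

/-! ### The special case in the tree FOLLOWS -/

/-- **The all-split special case `thm331_anticyclotomicControl` (lit-glue gen 6, registry A174)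
FOLLOWS from the general statement**: at a field in which every `ℓ ∣ N` splits,
`∏_{w∣N, w split} c_w(E/K) = ∏_w c_w(E/K)` (`splitTamagawaProduct_eq_tamagawaProduct_of_heegnerHypothesis`).
So the special case is DERIVABLE (a RETIRED-DERIVED candidate by annotation; its `def` stays for its
importers). [cite: JetchevSkinnerWan2017, Thm. 3.3.1 with §3.5 (3.5.d) (arXiv:1512.06894 pp. 11, 16)] -/
theorem thm331_anticyclotomicControl_of_general (h : thm331_anticyclotomicControl_general) :
    thm331_anticyclotomicControl := by
  intro W _ _ p _ hp hgood K _ _ hK hHp hHN hirr ι v hv κ hκ γ _ hrk hfin P hP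
  obtain ⟨htors, F, hF, hF0, hval⟩ := h W p hp hgood K hK hHp hirr ι v hv κ hκ γ hrk hfin P hP
  refine ⟨htors, F, hF, hF0, ?_⟩
  rw [hval, splitTamagawaProduct_eq_tamagawaProduct_of_heegnerHypothesis W K hHN]

variable {W : WeierstrassCurve ℚ} [W.IsElliptic] [W.IsGloballyMinimal] {p : ℕ} [Fact p.Prime]

/-! ### Bookkeeping consumers -/

/-- **Thm. 3.3.1 + (3.5.d), general `K`, in the packaged currency** `AcSelmer.XAc.HasCharValuationAt …
n` ("`X_ac` is `Λ`-torsion with a generator `f`, `f(0) ≠ 0`, `ord_p f(0) = n`") `∧ n =` the printed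
right-hand side with the split Tamagawa product — literally the body shape of the cell's Summits-side
predicate `X11b.ControlOnTreeGoodAt p κ v γ ι P` (Castella 2018 Thm. 2.3 with `ε_p = p⁻¹`, log at the
strict prime, Tamagawa term `∏_{w∣N⁺} c_w = X11b.tamagawaProductSplit W K`, definitionally
`splitTamagawaProduct W K`). [cite: JetchevSkinnerWan2017, Thm. 3.3.1 with (3.5.d)] [cite: Castella2018, Thm. 2.3 (arXiv:1704.06608 p. 5)] -/
theorem hasCharValuationAt_of_thm331_general (h : thm331_anticyclotomicControl_general) (hp : 3 ≤ p)
    (hgood : Good W p) (K : Type) [Field K] [NumberField K] (hK : IsImaginaryQuadratic K)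
    (hHp : SatisfiesHeegnerHypothesis p K)
    (hirr : (W.baseChange K).HasIrreducibleModPGaloisRep p)
    (ι : K →+* ℚ_[p]) (v : HeightOneSpectrum (𝓞 K))
    (hv : ∀ x : 𝓞 K, x ∈ v.asIdeal ↔ ‖ι (x : K)‖ < 1)
    (κ : ZpExtension K p) (hκ : κ.IsAnticyclotomic)
    (γ : absoluteGaloisGroup K) [Fact (κ.IsTopGenerator γ)]
    (hrk : (W.baseChange K).mordellWeilRank = 1)
    (hfin : Finite (AddCommGroup.primaryComponent (W.baseChange K).sha p))
    (P : (W.baseChange K).toAffine.Point) (hP : ¬ IsOfFinAddOrder P) :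
    ∃ n : ℕ, AcSelmer.XAc.HasCharValuationAt (W.baseChange K) p κ v ∅ γ n ∧
      (n : ℤ) = (padicValNat p (Nat.card (AddCommGroup.primaryComponent (W.baseChange K).sha p)) : ℤ) +
        2 * (((padicValInt p (1 - W.frobeniusTrace p + p) : ℤ) - 1 + padicLogOrd W p ι P) -
          (padicValNat p (AddSubgroup.zmultiples P).index : ℤ)) +
        (padicValNat p (splitTamagawaProduct W K) : ℤ) := by
  obtain ⟨htors, F, hF, hF0, hval⟩ := h W p hp hgood K hK hHp hirr ι v hv κ hκ γ hrk hfin P hP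
  exact ⟨(PowerSeries.constantCoeff F).valuation,
    AcSelmer.XAc.hasCharValuationAt_of_eq htors hF hF0 rfl, hval⟩

/-- **Every generator has the printed valuation** (general `K`): granted Thm. 3.3.1 + (3.5.d), if
`Ch(X_ac) = (g)` for ANY `g ∈ Λ`, then `g(0) ≠ 0` and `ord_p g(0)` equals the printed right-hand side
(two generators differ by a unit of `Λ`; `AcSelmer.valuation_constantCoeff_eq_of_span_singleton_eq`).
[cite: JetchevSkinnerWan2017, Thm. 3.3.1 (arXiv Thm. 8, p. 11)] -/
theorem thm331_general_padicVal_eq_of_generator (h : thm331_anticyclotomicControl_general)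
    (hp : 3 ≤ p) (hgood : Good W p) (K : Type) [Field K] [NumberField K]
    (hK : IsImaginaryQuadratic K) (hHp : SatisfiesHeegnerHypothesis p K)
    (hirr : (W.baseChange K).HasIrreducibleModPGaloisRep p)
    (ι : K →+* ℚ_[p]) (v : HeightOneSpectrum (𝓞 K))
    (hv : ∀ x : 𝓞 K, x ∈ v.asIdeal ↔ ‖ι (x : K)‖ < 1)
    (κ : ZpExtension K p) (hκ : κ.IsAnticyclotomic)
    (γ : absoluteGaloisGroup K) [Fact (κ.IsTopGenerator γ)]
    (hrk : (W.baseChange K).mordellWeilRank = 1)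
    (hfin : Finite (AddCommGroup.primaryComponent (W.baseChange K).sha p))
    (P : (W.baseChange K).toAffine.Point) (hP : ¬ IsOfFinAddOrder P)
    (G : IwasawaAlgebra p) (hG : AcSelmer.XAc.charIdeal (W.baseChange K) p κ v ∅ γ = Ideal.span {G}) :
    PowerSeries.constantCoeff G ≠ 0 ∧
      ((PowerSeries.constantCoeff G).valuation : ℤ) =
        (padicValNat p (Nat.card (AddCommGroup.primaryComponent (W.baseChange K).sha p)) : ℤ) +
          2 * (((padicValInt p (1 - W.frobeniusTrace p + p) : ℤ) - 1 + padicLogOrd W p ι P) -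
            (padicValNat p (AddSubgroup.zmultiples P).index : ℤ)) +
          (padicValNat p (splitTamagawaProduct W K) : ℤ) := by
  obtain ⟨-, F, hF, hF0, hval⟩ := h W p hp hgood K hK hHp hirr ι v hv κ hκ γ hrk hfin P hP
  obtain ⟨hG0, hGF⟩ := AcSelmer.valuation_constantCoeff_eq_of_span_singleton_eq (hF.symm.trans hG) hF0
  exact ⟨hG0, by rw [hGF]; exact hval⟩

end Literature.NumberTheory.EllipticCurves.JetchevSkinnerWan2017

end
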